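import Literature.Algebra.EuclideanLattices.LatticeGapNPcoNPLemmaA1
import Literature.Algebra.EuclideanLattices.GapSVPVerifier
import HarnessLib

/-!
# The coNP witness for `GapCVP_{c√n}` (Aharonov–Regev 2005, §6) in integer form: soundness proved, completeness and the verifier machine as named facts, Thm. 1.1 (coNP part) assembled

Topic `Algebra/EuclideanLattices` (family `pqc`). Decomposition file (D-0014) of the named fact
`Literature.Algebra.EuclideanLattices.gapCVP_sqrt_mem_promiseCoNP` of `LatticeGapNPcoNP.lean`
("`∃ c > 0, GapCVP_{c√n} ∈ PromiseCoNP`", the coNP part of Aharonov–Regev 2005, Thm. 1.1 — the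
heart of the paper), the last open leaf of Cor. 1.2 (`gapSVP_sqrt_mem_promiseNP_inter_promiseCoNP`).

## The printed verifier (authors' version, `lit read paper:doi-10-1109-focs-2004-35`, §6 p. 10)

"The witness is a sequence of vectors `w₁, …, w_N` [in `L*`] … The verifier performs three tests
and accepts if and only if all of them are satisfied: (a) checks that `f_W(v) < 1/2`
[`f_W(v) = N⁻¹ ∑ cos(2π⟨v, wⱼ⟩)`], (b) checks that the `wᵢ`'s are in the dual lattice `L*`,
(c) checks that the maximal eigenvalue of the `n × n` positive semidefinite matrix `W Wᵀ` is at
most `3N`." Soundness (§6.1, p. 11): for `v` at distance `≤ 1/100` from `L`, with `x = v − `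
(closest lattice point), `N⁻¹ ∑ ⟨x, wⱼ⟩² = N⁻¹ xᵀ W Wᵀ x ≤ 3/10000` and
`cos y ≥ 1 − y²/2` give `f_W(v) ≥ 1 − 6π²/10000 > 1/2`. Completeness (§6.2, pp. 11–12):
`wⱼ` i.i.d. from the Fourier distribution `f̂ = D_{L*}` passes (a) by Lemma 3.1 + Lemma 1.3
(Claim 6.1) and (c) by Lemmas 2.5, 2.6, 6.2 (Lemma 6.3).

## The verifier formalised here (same theorem, integer arithmetic only)

The tree's instances `((B, t), d)` carry an INTEGER basis (rows `bᵢ`), an INTEGER target and a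
rational `d` (`Problems.lean`). We render the three tests on such data with a certificate
(`FarCert`) made of integers only, so that the polynomial-time verifier is plain integer matrix
arithmetic (no cosines, no eigenvalues), trading the printed real-number tests for CERTIFIED
integer ones; the class-membership theorem proved from it is literally the vendored fact:

* the dual vectors are given by integer coordinate vectors `aⱼ ∈ ℤⁿ` (rows of `A`) together with
  an integer matrix `C` and `δ ≠ 0` with `C B = B C = δ I` (so `B⁻¹ = C/δ` and
  `wⱼ = B⁻¹ aⱼ ∈ L*` AUTOMATICALLY — test (b) is built into the format: `⟨wⱼ, bᵢ⟩ = (aⱼ)ᵢ`);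
* test (a) is replaced by COUNTING far phases: `⟨wⱼ, t⟩ = pⱼ/δ` with the integer
  `pⱼ = aⱼ · (t C)`; `j` is *far* if `pⱼ/δ` is at distance `≥ 1/8` from `ℤ` (an integer test on
  `pⱼ mod |δ|`), and the verifier asks `4 · #{far j} > N` — in place of the mean of cosines
  (for a point within `d` of the lattice few phases are far; for a far point a constant fraction
  of the phases of a random dual witness are far, because `E cos(2π⟨w, t⟩) = f(t)` is tiny);
* test (c), `WᵀW ≼ κ I` with `κ = N/(2 s²)`, `s = 100 d` (the paper's threshold `3N · (2π)⁻¹`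
  after undoing its normalisation `d = 1/100`, rounded up to the rational `N/2s²`), is the
  positive semidefiniteness of the INTEGER matrix `Q = N den(d)² · B Bᵀ − 20000 num(d)² · AᵀA`,
  CERTIFIED by an integer matrix `R` and `σ ≠ 0` with `σ² Q = RᵀR` (rational `LDLᵀ` and four
  squares; checked by two matrix products).

## Relation to `ARVerifierAlgebra.lean` (a second integer design in the tree)

`ARVerifierAlgebra.lean` (accepted earlier the same day, serving the provefact decomposition of
the barrier entry `Literature.Barriers.PneNP.LatticeGapCoNP`) prepares a DIFFERENT all-integer
variant of the same printed verifier: test (a) as a lower bound on `∑ⱼ ‖⟨v, wⱼ⟩‖²_{ℝ/ℤ}` with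
prover-named nearest integers, test (c) as the trace test `trace ((W Wᵀ)^k) ≤ Λ^k`, `k = 2^m ≥ n`,
with its real soundness/completeness inequalities proved there. The present file is an
ALTERNATIVE decomposition of the same leaf `gapCVP_sqrt_mem_promiseCoNP`, chosen for the machine:
here test (c) costs the verifier two integer matrix products (`σ² Q` versus `RᵀR`) instead of
`log n` squarings of an `n × n` matrix (whose doubling bit-growth needs clipped loops in the `FP`
algebra), and test (a) is the exact `mod |δ|` test (no nearest-integer bookkeeping); the price is
paid inside the completeness fact, which must also produce the certificate `(R, σ)` (rational
`LDLᵀ` of a positive semidefinite matrix and Lagrange's four squares, polynomial bit size by the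
subdeterminant bounds of Gaussian elimination). Soundness below is proved from scratch in exact
integer arithmetic and uses nothing from `ARVerifierAlgebra.lean`; its lemmas
(`dotProduct_mulVec_le_of_trace_pow_le`, `trace_pow_le_card_mul_pow`, the `distInt` facts) stay
valid and would serve a trace-test certificate-free variant of `Accepts` if that route is
preferred later. Whichever design first acquires BOTH its machine fact and its completeness fact
discharges the leaf for all three dependants (Cor. 1.2 here, Thm. 1.1 in
`LatticeGapCVPNPcoNP.lean`, the barrier `LatticeGapCoNP`). refactor (librarian): once one route is
complete, mark the other design's bricks as superseded in their headers.

Contents: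

* `FarCert`, `FarCert.Accepts` (the acceptance predicate, decidable integer arithmetic),
  `FarCert.bitSize`;
* **soundness PROVED** (`FarCert.not_accepts_of_yes`, AR05 §6.1 in integer form): on a YES
  instance (`dist(t, L(B)) ≤ d`) no certificate is accepted — the closest lattice vector `z B`
  leaves an INTEGER error `e = t − z B` with `den² ‖e‖² ≤ num²`; far phases force
  `64 θⱼ² ≥ δ²` for the integers `θⱼ = aⱼ · (e C)`, the certificate gives
  `20000 num² ∑ θⱼ² ≤ N den² δ² ‖e‖² ≤ N δ² num²`, whence `20000 · #far ≤ 64 N`, contradicting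
  `4 · #far > N`;
* **completeness** as the named fact `FarCert.complete` (AR05 §6.2: for `dist(t, L(B)) > c₀ √n d`
  some certificate of polynomial bit size is accepted; printed proof = Poisson summation
  (Claim 4.1), Banaszczyk's Lemmas 2.5/2.6, Chernoff–Hoeffding, the net Lemma 6.2 — in the tree:
  Poisson summation for lattices is PROVED, `NumberTheory/LFunctions/DedekindZetaPoissonProofs.lean`;
  the Banaszczyk bounds are the named facts of `PQCDiscreteGaussian.lean`);
* **the machine** as the named fact `FarCert.verifier_mem_P` (AR05 §6 p. 10: "It is easy to see
  that the verifier can be implemented in polynomial time"; TM2 level: a `P` language deciding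
  `Accepts` on coded pairs, total in the witness string, with a polynomial-length coding of
  certificates — to be assembled from `Computability/Complexity/IntVectorBricks.lean` like the
  `NP` verifier of `GapSVPVerifier.lean`);
* **the assembly PROVED**: `gapCVP_sqrt_mem_promiseCoNP_of` — the two facts give
  `gapCVP_sqrt_mem_promiseCoNP`; with the NP leaf and Lemma A.1,
  `gapSVP_sqrt_mem_promiseNP_inter_promiseCoNP_of_farCert`.

## References

* D. Aharonov, O. Regev, *Lattice problems in NP ∩ coNP*, J. ACM 52 (2005) 749–765, Thm. 1.1,
  §6 (pp. 10–12 of the authors' version), Lemmas 2.5, 2.6, 3.1, Claim 4.1, Lemma 6.2.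
* W. Banaszczyk, *New bounds in some transference theorems in the geometry of numbers*,
  Math. Ann. 296 (1993), Lemmas 1.3, 1.5.
* D. Micciancio, S. Goldwasser, *Complexity of Lattice Problems*, Kluwer 2002, Ch. 1 §1.2.
-/

noncomputable section

open Computability Literature.Computability.Complexity Literature.Computability.Complexity.Nondeterministic
open Matrix Metric

namespace Literature.Algebra.EuclideanLattices

/-! ### Certificates and the acceptance predicate -/

/-- An integer far-ness certificate for a `GapCVP` instance of dimension `n` (AR05 §6 witness in
integer form): `N` dual vectors by integer coordinates `A` (rows `aⱼ`, `wⱼ = B⁻¹ aⱼ`), an integer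
inverse `C`, `δ` of the basis (`C B = B C = δ I`), and a positive-semidefiniteness certificate
`(R, σ)` for the moment matrix (`σ² Q = RᵀR`). [cite: AharonovRegev2005, §6 (p. 10: the witness W and tests (a)–(c))] -/
structure FarCert (n : ℕ) where
  /-- number of dual vectors -/
  N : ℕ
  /-- the dual vectors, by integer coordinates: row `j` is `aⱼ = B wⱼ ∈ ℤⁿ` -/
  A : Matrix (Fin N) (Fin n) ℤ
  /-- an integer matrix with `C B = B C = δ I` -/
  C : Matrix (Fin n) (Fin n) ℤ
  /-- the common denominator of `B⁻¹ = C / δ` -/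
  δ : ℤ
  /-- number of rows of the PSD certificate -/
  m : ℕ
  /-- the PSD certificate: `σ² Q = Rᵀ R` -/
  R : Matrix (Fin m) (Fin n) ℤ
  /-- its denominator -/
  σ : ℕ

namespace FarCert

variable {n : ℕ}

/-- The integer phase `pⱼ = aⱼ · (t C)` of the `j`-th dual vector at the target `t`
(`⟨wⱼ, t⟩ = pⱼ / δ`). [cite: AharonovRegev2005, §6 test (a)] -/
def phase (c : FarCert n) (t : Fin n → ℤ) (j : Fin c.N) : ℤ := c.A j ⬝ᵥ (t ᵥ* c.C)

/-- The `j`-th phase is FAR: `pⱼ / δ` is at distance at least `1/8` from `ℤ`, as the integer test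
`|δ| ≤ 8 r ∧ |δ| ≤ 8 (|δ| − r)` on `r = pⱼ mod |δ|`. [cite: AharonovRegev2005, §6 test (a) (counting form)] -/
def Far (c : FarCert n) (t : Fin n → ℤ) (j : Fin c.N) : Prop :=
  (c.δ.natAbs : ℤ) ≤ 8 * (c.phase t j % c.δ.natAbs) ∧
    (c.δ.natAbs : ℤ) ≤ 8 * (c.δ.natAbs - c.phase t j % c.δ.natAbs)

/-- Far-ness is a decidable integer test. [folklore] -/
instance (c : FarCert n) (t : Fin n → ℤ) : DecidablePred (c.Far t) := fun _ =>
  inferInstanceAs (Decidable (_ ∧ _))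

/-- The number of far phases. [cite: AharonovRegev2005, §6 test (a)] -/
def farCount (c : FarCert n) (t : Fin n → ℤ) : ℕ := (Finset.univ.filter (c.Far t)).card

/-- The integer moment matrix `Q = N den² · B Bᵀ − 20000 num² · AᵀA` whose positive
semidefiniteness is `WᵀW ≼ (N / 2s²) I`, `s = 100 d`. [cite: AharonovRegev2005, §6 test (c)] -/
def momentMatrix (c : FarCert n) (B : Matrix (Fin n) (Fin n) ℤ) (d : ℚ) : Matrix (Fin n) (Fin n) ℤ :=
  ((c.N : ℤ) * (d.den : ℤ) ^ 2) • (B * Bᵀ) - (20000 * d.num ^ 2) • (c.Aᵀ * c.A)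

/-- **The verifier's acceptance predicate** on an instance `((B, t), d)` and a certificate:
`δ ≠ 0`, `C B = δ I`, `B C = δ I`, `σ ≠ 0`, `σ² Q = RᵀR`, and `N < 4 · #far`. (For square
matrices `C B = δ I` implies `B C = δ I` — `Matrix.mul_eq_one_comm` after dividing out `δ` over
`ℚ`; both are checked, a harmless redundancy that keeps the soundness proof in `ℤ`.)
[cite: AharonovRegev2005, §6 (p. 10, tests (a)–(c))] -/
def Accepts (p : GapCVPInstance) (c : FarCert p.1.I.n) : Prop :=
  c.δ ≠ 0 ∧ c.C * p.1.I.basis = c.δ • (1 : Matrix _ _ ℤ) ∧ p.1.I.basis * c.C = c.δ • (1 : Matrix _ _ ℤ) ∧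
    c.σ ≠ 0 ∧ ((c.σ : ℤ) ^ 2) • c.momentMatrix p.1.I.basis p.2 = c.Rᵀ * c.R ∧
    c.N < 4 * c.farCount p.1.target

/-- The bit size of a certificate: the number of its integer entries plus the binary sizes of
all of them (the parameter of the polynomial length bound of its coding). [folklore] -/
def bitSize (c : FarCert n) : ℕ :=
  c.N * n + n * n + c.m * n + 2 + c.N + c.m +
    (∑ j, ∑ k, (c.A j k).natAbs.size) + (∑ i, ∑ k, (c.C i k).natAbs.size) + c.δ.natAbs.size +
    (∑ j, ∑ k, (c.R j k).natAbs.size) + c.σ.size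

/-! ### Soundness: YES instances accept no certificate (AR05 §6.1, integer form) -/

/-- Far phases are far from `δ ℤ`: if `θ ≡ p (mod δ)` and the phase `p` is far then `δ² ≤ 64 θ²`.
[cite: AharonovRegev2005, §6.1] -/
theorem sq_le_of_far {δ p θ : ℤ} (hδ : δ ≠ 0) (hcong : θ % δ.natAbs = p % δ.natAbs)
    (hfar : (δ.natAbs : ℤ) ≤ 8 * (p % δ.natAbs) ∧ (δ.natAbs : ℤ) ≤ 8 * (δ.natAbs - p % δ.natAbs)) :
    δ ^ 2 ≤ 64 * θ ^ 2 := by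
  set D : ℤ := (δ.natAbs : ℤ) with hD
  have hDpos : 0 < D := by rw [hD]; exact_mod_cast Int.natAbs_pos.2 hδ
  have hr0 : 0 ≤ θ % D := Int.emod_nonneg _ hDpos.ne'
  have hrD : θ % D < D := Int.emod_lt_of_pos _ hDpos
  have hdecomp : θ % D + D * (θ / D) = θ := Int.emod_add_mul_ediv θ D
  rw [← hcong] at hfar
  have hδ2 : δ ^ 2 = D ^ 2 := by rw [hD, Int.natAbs_sq]
  rw [hδ2]
  set q := θ / D
  set r := θ % D
  rcases le_or_gt 0 q with hq | hq
  · -- `θ ≥ r ≥ D/8`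
    have h1 : D ≤ 8 * θ := by nlinarith [hfar.1]
    nlinarith
  · -- `θ ≤ -D + r ≤ -D/8`
    have hq' : q ≤ -1 := by omega
    have h1 : 8 * θ ≤ -D := by nlinarith [hfar.2]
    nlinarith

/-- From `C B = δ I`: `(e C) B = δ e`. [folklore] -/
theorem vecMul_vecMul_of_mul_eq_smul {C B : Matrix (Fin n) (Fin n) ℤ} {δ : ℤ} (h : C * B = δ • (1 : Matrix _ _ ℤ))
    (e : Fin n → ℤ) : (e ᵥ* C) ᵥ* B = δ • e := by
  rw [Matrix.vecMul_vecMul, h, Matrix.vecMul_smul, Matrix.vecMul_one]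

/-- A quadratic form certified by `σ² Q = RᵀR` is nonnegative on integer vectors. [folklore] -/
theorem dotProduct_mulVec_nonneg_of_cert {m : ℕ} {Q : Matrix (Fin n) (Fin n) ℤ} {R : Matrix (Fin m) (Fin n) ℤ}
    {σ : ℤ} (hσ : σ ≠ 0) (h : (σ ^ 2) • Q = Rᵀ * R) (f : Fin n → ℤ) : 0 ≤ f ⬝ᵥ (Q *ᵥ f) := by
  have h1 : σ ^ 2 * (f ⬝ᵥ (Q *ᵥ f)) = (R *ᵥ f) ⬝ᵥ (R *ᵥ f) := by
    have := congrArg (fun M : Matrix (Fin n) (Fin n) ℤ => f ⬝ᵥ (M *ᵥ f)) h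
    simp only [Matrix.smul_mulVec, dotProduct_smul, smul_eq_mul] at this
    rw [this, ← Matrix.mulVec_mulVec, Matrix.dotProduct_mulVec, Matrix.vecMul_transpose]
  have h2 : 0 ≤ (R *ᵥ f) ⬝ᵥ (R *ᵥ f) := Finset.sum_nonneg fun i _ => mul_self_nonneg _
  have hσ2 : 0 < σ ^ 2 := by positivity
  nlinarith

/-- The quadratic form of the moment matrix: `f·Q f = N den² ‖f B‖² − 20000 num² ‖A f‖²`.
[cite: AharonovRegev2005, §6.1] -/
theorem dotProduct_momentMatrix_mulVec (c : FarCert n) (B : Matrix (Fin n) (Fin n) ℤ) (d : ℚ) (f : Fin n → ℤ) :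
    f ⬝ᵥ (c.momentMatrix B d *ᵥ f) =
      (c.N : ℤ) * (d.den : ℤ) ^ 2 * ((f ᵥ* B) ⬝ᵥ (f ᵥ* B)) - 20000 * d.num ^ 2 * ((c.A *ᵥ f) ⬝ᵥ (c.A *ᵥ f)) := by
  rw [momentMatrix, Matrix.sub_mulVec, dotProduct_sub, Matrix.smul_mulVec, Matrix.smul_mulVec, dotProduct_smul,
    dotProduct_smul, smul_eq_mul, smul_eq_mul, ← Matrix.mulVec_mulVec, ← Matrix.mulVec_mulVec,
    Matrix.dotProduct_mulVec f B, Matrix.mulVec_transpose, Matrix.dotProduct_mulVec f c.Aᵀ, Matrix.vecMul_transpose]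

/-- **Soundness** (AR05 §6.1 in integer form): on a YES instance of `GapCVP_γ`
(`B` nonsingular, `d > 0`, `dist(t, L(B)) ≤ d`) NO certificate is accepted.
[cite: AharonovRegev2005, §6.1 (p. 11)] -/
theorem not_accepts_of_yes {γ : ℕ → ℝ} {I : LatticeInstance} {t : Fin I.n → ℤ} {d : ℚ}
    (hp : ((⟨I, t⟩ : CVPInstance), d) ∈ GapCVP.yes γ) (c : FarCert I.n) :
    ¬ c.Accepts ((⟨I, t⟩ : CVPInstance), d) := by
  rintro ⟨hδ, hCB, hBC, hσ, hcert, hcount⟩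
  obtain ⟨hI, hd, hdist⟩ := hp
  dsimp only at hI hd hdist hCB hBC hcert hcount
  -- a closest lattice vector `z B` and the INTEGER error `e = t - z B`
  have hclosed : IsClosed (X := EuclideanSpace ℝ (Fin I.n)) I.lattice :=
    @AddSubgroup.isClosed_of_discrete _ _ _ _ _ I.lattice.toAddSubgroup
      (inferInstanceAs (DiscreteTopology I.lattice))
  obtain ⟨y, hyL, hy⟩ := hclosed.exists_infDist_eq_dist ⟨0, I.lattice.zero_mem⟩ (intVecToEuclidean I.n t)
  obtain ⟨z, rfl⟩ := (I.mem_lattice_iff y).1 hyL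
  set e : Fin I.n → ℤ := t - z ᵥ* I.basis with he
  have hte : t = z ᵥ* I.basis + e := by rw [he]; abel
  -- `den² ‖e‖² ≤ num²`
  have hnorm : dist (intVecToEuclidean I.n t) (I.ofCoeffs z) = ‖intVecToEuclidean I.n e‖ := by
    rw [dist_eq_norm, he, map_sub]
    rfl
  have hed : ‖intVecToEuclidean I.n e‖ ≤ d := by
    rw [← hnorm, ← hy]; exact hdist
  have hnum : 0 < d.num := Rat.num_pos.2 hd
  have hE : (d.den : ℤ) ^ 2 * (e ⬝ᵥ e) ≤ d.num ^ 2 := by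
    have hd' : (d : ℝ) = d.num / d.den := by exact_mod_cast (Rat.num_div_den d).symm
    have hden : (0 : ℝ) < d.den := by exact_mod_cast d.den_pos
    have h1 : ‖intVecToEuclidean I.n e‖ * d.den ≤ d.num := by
      rw [hd', le_div_iff₀ hden] at hed; exact hed
    have h2 : (‖intVecToEuclidean I.n e‖ * d.den) ^ 2 ≤ (d.num : ℝ) ^ 2 :=
      pow_le_pow_left₀ (by positivity) h1 2
    rw [mul_pow, norm_intVecToEuclidean, Real.sq_sqrt (Finset.sum_nonneg fun _ _ => sq_nonneg _)] at h2
    have h3 : ((d.den : ℤ) : ℝ) ^ 2 * ((e ⬝ᵥ e : ℤ) : ℝ) ≤ ((d.num : ℤ) : ℝ) ^ 2 := by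
      have hc : ((e ⬝ᵥ e : ℤ) : ℝ) = ∑ j, ((e j : ℝ)) ^ 2 := by
        rw [dotProduct]; push_cast; exact Finset.sum_congr rfl fun j _ => by ring
      have : ((d.den : ℤ) : ℝ) = (d.den : ℝ) := by norm_cast
      rw [hc, this]; linarith
    exact_mod_cast h3
  -- the integers `θⱼ = aⱼ · (e C)` and the decomposition `pⱼ = δ (aⱼ · z) + θⱼ`
  set f : Fin I.n → ℤ := e ᵥ* c.C with hf
  have hphase : ∀ j, c.phase t j = c.δ * (c.A j ⬝ᵥ z) + (c.A *ᵥ f) j := by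
    intro j
    rw [phase, hte, Matrix.add_vecMul, dotProduct_add, Matrix.vecMul_vecMul, hBC, Matrix.vecMul_smul,
      Matrix.vecMul_one, dotProduct_smul, smul_eq_mul, Matrix.mulVec, hf]
  -- far phases: `δ² ≤ 64 θⱼ²`
  have hfar : ∀ j, c.Far t j → c.δ ^ 2 ≤ 64 * ((c.A *ᵥ f) j) ^ 2 := by
    intro j hj
    refine sq_le_of_far hδ ?_ hj
    have hdec : c.phase t j = (c.A *ᵥ f) j + (c.δ.natAbs : ℤ) * (c.δ.sign * (c.A j ⬝ᵥ z)) := by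
      rw [hphase j]
      have hs := Int.sign_mul_natAbs c.δ
      linear_combination (-(c.A j ⬝ᵥ z)) * hs
    rw [hdec, Int.add_mul_emod_self_left]
  -- the certified quadratic form at `f`: `20000 num² ∑ θⱼ² ≤ N den² δ² ‖e‖² ≤ N δ² num²`
  have hfB : f ᵥ* I.basis = c.δ • e := vecMul_vecMul_of_mul_eq_smul hCB e
  have hQ := dotProduct_mulVec_nonneg_of_cert (by exact_mod_cast hσ : (c.σ : ℤ) ≠ 0) hcert f
  rw [dotProduct_momentMatrix_mulVec, hfB, smul_dotProduct, dotProduct_smul, smul_eq_mul, smul_eq_mul] at hQ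
  set S := (c.A *ᵥ f) ⬝ᵥ (c.A *ᵥ f) with hS
  have hS0 : 0 ≤ S := Finset.sum_nonneg fun j _ => mul_self_nonneg _
  have hee : 0 ≤ e ⬝ᵥ e := Finset.sum_nonneg fun j _ => mul_self_nonneg _
  have hδ2 : 0 < c.δ ^ 2 := by positivity
  have hnum2 : 0 < d.num ^ 2 := by positivity
  have h1 : 20000 * d.num ^ 2 * S ≤ (c.N : ℤ) * c.δ ^ 2 * ((d.den : ℤ) ^ 2 * (e ⬝ᵥ e)) := by nlinarith
  have h2 : (c.N : ℤ) * c.δ ^ 2 * ((d.den : ℤ) ^ 2 * (e ⬝ᵥ e)) ≤ (c.N : ℤ) * c.δ ^ 2 * d.num ^ 2 :=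
    mul_le_mul_of_nonneg_left hE (by positivity)
  have h3 : 20000 * S ≤ (c.N : ℤ) * c.δ ^ 2 := by nlinarith
  -- counting the far phases: `#far · δ² ≤ 64 S`
  have h4 : (c.farCount t : ℤ) * c.δ ^ 2 ≤ 64 * S := by
    have hsub : ∑ j ∈ Finset.univ.filter (c.Far t), ((c.A *ᵥ f) j) ^ 2 ≤ ∑ j, ((c.A *ᵥ f) j) ^ 2 :=
      Finset.sum_le_sum_of_subset_of_nonneg (Finset.filter_subset _ _) fun j _ _ => sq_nonneg _
    have hfar' : ∑ j ∈ Finset.univ.filter (c.Far t), c.δ ^ 2 ≤ ∑ j ∈ Finset.univ.filter (c.Far t), 64 * ((c.A *ᵥ f) j) ^ 2 :=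
      Finset.sum_le_sum fun j hj => hfar j (Finset.mem_filter.1 hj).2
    rw [Finset.sum_const, nsmul_eq_mul, ← Finset.mul_sum] at hfar'
    have hSsum : S = ∑ j, ((c.A *ᵥ f) j) ^ 2 := by
      rw [hS, dotProduct]; exact Finset.sum_congr rfl fun j _ => by ring
    rw [farCount, hSsum]
    linarith
  -- `20000 #far ≤ 64 N`, contradicting `N < 4 #far`
  have h5 : 20000 * (c.farCount t : ℤ) * c.δ ^ 2 ≤ 64 * (c.N : ℤ) * c.δ ^ 2 := by nlinarith
  have h6 : 20000 * (c.farCount t : ℤ) ≤ 64 * (c.N : ℤ) := le_of_mul_le_mul_right h5 hδ2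
  have h7 : (c.N : ℤ) < 4 * (c.farCount t : ℤ) := by exact_mod_cast hcount
  omega

/-- **Soundness** for an instance in bundled form. [cite: AharonovRegev2005, §6.1 (p. 11)] -/
theorem not_accepts_of_yes' {γ : ℕ → ℝ} {p : GapCVPInstance} (hp : p ∈ GapCVP.yes γ) (c : FarCert p.1.I.n) :
    ¬ c.Accepts p := by
  obtain ⟨⟨I, t⟩, d⟩ := p
  exact not_accepts_of_yes hp c

/-! ### Completeness and the machine: the named facts -/

/-- **Completeness** (VARIANT of Aharonov–Regev 2005, §6.2 for the integer verifier `Accepts`;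
NAMED FACT — constants differ from print; the analytic heart of the paper): there are an absolute
constant `c₀ > 0` and a polynomial `q` such that every NO instance `((B, t), d)` of `GapCVP_{c₀√n}`
(`dist(t, L(B)) > c₀ √n · d`) has an accepted certificate of bit size `≤ q(|code|)`.
Printed proof (§6.2, pp. 11–12, for the printed tests `f_W(v) < 1/2`, `λ_max(W Wᵀ) ≤ 3N`):
`wⱼ` i.i.d. from the Fourier distribution `f̂ = D_{L*}` of `f = ρ(L − ·)/ρ(L)` (Claim 4.1);
test (a) by Lemma 3.1 and Chernoff–Hoeffding (Claim 6.1); test (c) by Lemma 2.5 (norm tail),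
Lemma 2.6 (`E⟨u, w⟩² ≤ 1/2π`) and the net Lemma 6.2 (Lemma 6.3). The two EXTRA steps for the
present tests, with their numbers: (i) *bucketing for the count test* — a phase within `1/8` of `ℤ`
has `cos(2πθ) ≥ cos(π/4) = √2/2`, so `E cos(2π⟨w, t⟩) = f(t)` (Claim 4.1; tree:
`tsum_gaussianFunction_sub_div_eq`, `GaussianLatticeSums.lean`) gives
`Pr[far] ≥ (√2/2 − f(t))/(1 + √2/2) > 0.41 > 1/4` as soon as `f(t) < 10⁻²`, which Lemma 3.1
(Banaszczyk's Lemma 1.5; tree: `GaussianLatticeTails.lean`) gives in every dimension `n ≥ 1` for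
`c₀` large (with the scaling `s = 100 d`, far means `dist > (c₀/100) √n s`; `c₀ = 300` suffices),
and then a second-moment (Chebyshev) or Hoeffding bound over `N ≥ 100` samples yields
`#far > N/4` with probability `≥ 0.9`; (ii) *the threshold of the moment test* — `momentMatrix ⪰ 0`
is `WᵀW ≼ κ I` with `κ = N/(2s²)`, which is NOT the printed Lemma 6.3 threshold `3N` (obtained
there with `r = 1`) but Lemma 6.2 run with `r² = 1/(2π s²)` from Lemma 2.6 (scaled), giving
`3N r² = 3N/(2π s²) ≈ 0.477 N/s² ≤ N/(2 s²)`; the net/Hoeffding argument of Lemma 6.2 can be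
replaced by truncation at `‖w‖ ≤ 4√n/s` (Lemma 2.5) and a Frobenius-norm second-moment bound with
`N = O(n²)` samples. For the integer format: `aⱼ = B wⱼ`, `C = adj B`, `δ = det B`, and the PSD
certificate `(R, σ)` from a rational `LDLᵀ` decomposition (symmetric pivoting) with Lagrange's four
squares on the pivots; all of polynomial bit size (Hadamard's bound; subdeterminant bounds for
Gaussian elimination). (Tree status: Poisson summation for lattices, the shifted Poisson identity,
`f` as a cosine average, Banaszczyk's Lemma 1.5 and AR Lemma 3.1 are PROVED —
`NumberTheory/LFunctions/DedekindZetaPoissonProofs.lean`, `GaussianLatticeSums.lean`,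
`GaussianLatticeTails.lean`; Lemma 2.6, the sampling step and the certificate algebra are not.)
[cite: AharonovRegev2005, §6.2 (pp. 11–12), with Lemmas 2.5, 2.6, 3.1, Claim 4.1, Lemma 6.2 — variant, constants differ from print] -/
def complete : Prop :=
  ∃ c₀ : ℝ, 0 < c₀ ∧ ∃ q : Polynomial ℕ, ∀ p : GapCVPInstance, p ∈ GapCVP.no (fun n => c₀ * Real.sqrt n) →
    ∃ c : FarCert p.1.I.n, c.Accepts p ∧ c.bitSize ≤ q.eval (gapCVPInstanceEncoding.encode p).length

/-- **The verifier is polynomial-time** (Aharonov–Regev 2005, §6 p. 10: "It is easy to see that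
the verifier can be implemented in polynomial time"; NAMED FACT at the `TM2` level): there are a
language `V ∈ P` of pairs `⟨instance code, certificate string⟩`, a coding `enc` of certificates
of polynomial length in their bit size, such that on the code of an instance (i) the coded
certificate is in `V` iff it is accepted and (ii) EVERY string in `V` denotes SOME accepted
certificate (total decoding — what makes the verifier sound against malformed witnesses).
To be assembled from the integer/vector bricks of `Computability/Complexity/IntVectorBricks.lean`
(integer matrix products, comparisons, a counting loop), like `GapSVPVerifier.lean`.
[cite: AharonovRegev2005, §6 (p. 10)] -/
def verifier_mem_P : Prop :=
  ∃ V : Language Bool, V ∈ Classes.P ∧ ∃ enc : (n : ℕ) → FarCert n → List Bool, ∃ q : Polynomial ℕ,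
    (∀ (p : GapCVPInstance) (c : FarCert p.1.I.n),
      boolPair (gapCVPInstanceEncoding.encode p) (enc _ c) ∈ V ↔ c.Accepts p) ∧
    (∀ (p : GapCVPInstance) (w : List Bool),
      boolPair (gapCVPInstanceEncoding.encode p) w ∈ V → ∃ c : FarCert p.1.I.n, c.Accepts p) ∧
    (∀ (n : ℕ) (c : FarCert n), (enc n c).length ≤ q.eval c.bitSize)

end FarCert

/-! ### Assembly: the coNP part of Theorem 1.1, and Cor. 1.2 -/

/-- **Aharonov–Regev 2005, Thm. 1.1, coNP part, from the two facts** (soundness being proved):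
`∃ c > 0, GapCVP_{c√n} ∈ PromiseCoNP`. The separating `coNP` language is the complement of
`{x | ∃ w, |w| ≤ q(|x|) ∧ ⟨x, w⟩ ∈ V}`. [cite: AharonovRegev2005, Thm. 1.1 (p. 2) and §6 (pp. 10–12)] -/
theorem gapCVP_sqrt_mem_promiseCoNP_of (hV : FarCert.verifier_mem_P) (hC : FarCert.complete) :
    gapCVP_sqrt_mem_promiseCoNP := by
  obtain ⟨V, hVP, enc, qV, hiff, htotal, hlen⟩ := hV
  obtain ⟨c₀, hc₀, qC, hcomplete⟩ := hC
  refine ⟨c₀, hc₀, ?_⟩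
  set K' : Language Bool := {x | ∃ w : List Bool, w.length ≤ (qV.comp qC).eval x.length ∧ boolPair x w ∈ V} with hK'
  have hK'NP : K' ∈ Nondeterministic.NP := ⟨V, hVP, qV.comp qC, fun _ => Iff.rfl⟩
  refine ⟨K'ᶜ, ?_, ?_, ?_⟩
  · change K'ᶜᶜ ∈ Nondeterministic.NP
    rwa [compl_compl]
  · rintro x hx
    rw [gapCVPPromise_yes] at hx
    obtain ⟨p, hp, rfl⟩ := hx
    rintro ⟨w, -, hw⟩
    obtain ⟨c, hc⟩ := htotal p w hw
    exact FarCert.not_accepts_of_yes' hp c hc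
  · rintro x hx
    rw [gapCVPPromise_no] at hx
    obtain ⟨p, hp, rfl⟩ := hx
    intro hx'
    apply hx'
    obtain ⟨c, hacc, hsize⟩ := hcomplete p hp
    refine ⟨enc _ c, ?_, (hiff p c).2 hacc⟩
    rw [Polynomial.eval_comp]
    exact (hlen _ c).trans (TM2Iter.eval_mono qV hsize)

/-- **Aharonov–Regev 2005, Cor. 1.2, reduced to the two facts of this file and the NP leaf**:
with Lemma A.1 discharged (`LatticeGapNPcoNPLemmaA1.lean`),
`gapSVP_sqrt_mem_promiseNP_inter_promiseCoNP` follows from `gapSVP_mem_promiseNP`,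
`FarCert.verifier_mem_P` and `FarCert.complete`. [cite: AharonovRegev2005, Cor. 1.2 (p. 2)] -/
theorem gapSVP_sqrt_mem_promiseNP_inter_promiseCoNP_of_farCert (hNP : gapSVP_mem_promiseNP)
    (hV : FarCert.verifier_mem_P) (hC : FarCert.complete) : gapSVP_sqrt_mem_promiseNP_inter_promiseCoNP :=
  gapSVP_sqrt_mem_promiseNP_inter_promiseCoNP_of_NP_of_coNP hNP (gapCVP_sqrt_mem_promiseCoNP_of hV hC)

/-- **Aharonov–Regev 2005, Cor. 1.2 — current conditional form of the vendored fact.** With the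
NP leaf (`gapSVP_mem_promiseNP_holds`, `GapSVPVerifier.lean`) and Lemma A.1
(`AharonovRegev2005_lemmaA1_holds`) discharged, `gapSVP_sqrt_mem_promiseNP_inter_promiseCoNP`
depends on exactly the two named facts of this file: the machine `FarCert.verifier_mem_P` and the
analysis `FarCert.complete` (together: the coNP part of Thm. 1.1). When both are discharged this
becomes `gapSVP_sqrt_mem_promiseNP_inter_promiseCoNP_holds`. (The shared coNP leaf itself, for
`LatticeGapCVPNPcoNP.lean` and the barrier `LatticeGapCoNP`, is `gapCVP_sqrt_mem_promiseCoNP_of hV hC`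
above.) [cite: AharonovRegev2005, Cor. 1.2 (p. 2), from Thm. 1.1 and Lemma A.1 (p. 14)] -/
theorem gapSVP_sqrt_mem_promiseNP_inter_promiseCoNP_of_farCert' (hV : FarCert.verifier_mem_P)
    (hC : FarCert.complete) : gapSVP_sqrt_mem_promiseNP_inter_promiseCoNP :=
  gapSVP_sqrt_mem_promiseNP_inter_promiseCoNP_of_farCert gapSVP_mem_promiseNP_holds hV hC

end Literature.Algebra.EuclideanLattices

end
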